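import Summits.AtomisticToContinuum.HydrodynamicLimit.Theorems.TwoClocksEquilibriumShearWindowLDWindows
import Summits.AtomisticToContinuum.HydrodynamicLimit.Theorems.KineticWindowGronwall.Negative.ActivityDummy

/-!
# `EquilibriumShearWindowLD`: normal form — unit activity, ONE positive tilt per test function
# (route TwoClocks, stmt-AtomisticToContinuum-14446; convexity in `β`)

Helper file (`--supports` stmt-AtomisticToContinuum-14446). The item
`TwoClocks.EquilibriumShearWindowLD` asks, for every activity `a₀ > 0`, temperature `θ₀ > 0`, flow
family and continuous `φ`, for a whole interval of tilts `|β| ≤ β₀` at which the window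
exponential moment `M_N(β, τ; φ) = ∫ exp(β ∑ᵢ w⁻¹∫₀ʷ φ(xᵢ(r)) vᵢ⁰(r) vᵢ¹(r) dr) dG_N`,
`w = τ(N+1)^{-1/3}`, is `≤ exp(ε(N+1))` eventually in `N` for a suitable `τ = τ(ε)`. Two of these
quantifiers are decorative:

* the ACTIVITY: at fixed particle number a constant activity cancels from the canonical density,
  `G_N(a₀) = G_N(1)` (`KineticWindowGronwallNegative.localGibbsLaw_const_activity`);
* the INTERVAL OF TILTS: `β ↦ log M_N(β, τ; φ)` is convex with value `0` at `β = 0`, so the bound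
  at ONE tilt `β₁ > 0` gives it on `[0, β₁]` (`lintegral_exp_mul_le_of_le`: Lyapunov's inequality
  `∫ g^p ≤ (∫ g)^p`, `p = β/β₁ ≤ 1`, on a probability space), and the negative tilts of `φ` are the
  positive tilts of `-φ` (`shearWindowSum_neg`).

Hence (`equilibriumShearWindowLD_iff_single_tilt`) the item is EQUIVALENT to its normal form: unit
activity and, for every continuous `φ`, ONE tilt `β > 0` (depending on everything before it) with
`∀ ε > 0 ∃ τ ∃ N₀ ∀ N ≥ N₀, M_N(β, τ; φ) ≤ exp(ε(N+1))`. Nothing dynamical is proved: the item (the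
`u₀ = 0`, `F = φ v⁰v¹` instance of the crux `EquilibriumFastWindowLD`, stmt-14440) stays open; this
file only removes two layers of quantifiers from what has to be shown.

References: S. Olla, S. R. S. Varadhan, H.-T. Yau, Comm. Math. Phys. 155 (1993) 523, §2
(exponential-moment currency; convexity of the pressure in the tilt).

prover-pitem-stmt-AtomisticToContinuum-14446-c2-0.
-/

noncomputable section

open MeasureTheory Real Set
open scoped ENNReal

namespace Summit.AtomisticToContinuum.HydrodynamicLimit.Theorems

open Literature.Analysis.FluidPDE Literature.MathematicalPhysics.KineticTheory
open Summit.AtomisticToContinuum.HydrodynamicLimit.Theses.TwoClocks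

/-! ### Convexity in the tilt: Lyapunov's inequality -/

/-- **Lyapunov's inequality** on a probability space: `∫ g^p ≤ (∫ g)^p` for `0 ≤ p ≤ 1`
(Hölder with the pair of exponents `p, 1 - p` against the constant `1`,
`ENNReal.lintegral_mul_norm_pow_le`). [folklore] -/
theorem lintegral_rpow_le_rpow_lintegral_of_le_one {α : Type*} [MeasurableSpace α]
    {μ : Measure α} [IsProbabilityMeasure μ] {g : α → ℝ≥0∞} (hg : AEMeasurable g μ) {p : ℝ}
    (hp0 : 0 ≤ p) (hp1 : p ≤ 1) :
    ∫⁻ x, g x ^ p ∂μ ≤ (∫⁻ x, g x ∂μ) ^ p := by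
  have h := ENNReal.lintegral_mul_norm_pow_le (f := g) (g := fun _ => (1 : ℝ≥0∞)) hg
    aemeasurable_const hp0 (sub_nonneg.2 hp1) (by ring)
  simpa only [ENNReal.one_rpow, mul_one, lintegral_const, measure_univ] using h

/-- **Exponential moments are log-convex in the tilt (from `0`).** On a probability space, for an
a.e.-measurable real `f` and tilts `0 ≤ β ≤ β₁`, `0 < β₁`:
`∫ exp(β f) ≤ (∫ exp(β₁ f))^{β/β₁}` (Lyapunov with `p = β/β₁`). [folklore] -/
theorem lintegral_exp_mul_le_rpow {α : Type*} [MeasurableSpace α] {μ : Measure α}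
    [IsProbabilityMeasure μ] {f : α → ℝ} (hf : AEMeasurable f μ) {β β₁ : ℝ} (hβ1 : 0 < β₁)
    (hβ0 : 0 ≤ β) (hβ : β ≤ β₁) :
    ∫⁻ x, ENNReal.ofReal (Real.exp (β * f x)) ∂μ ≤
      (∫⁻ x, ENNReal.ofReal (Real.exp (β₁ * f x)) ∂μ) ^ (β / β₁) := by
  have hp0 : 0 ≤ β / β₁ := div_nonneg hβ0 hβ1.le
  have hp1 : β / β₁ ≤ 1 := (div_le_one hβ1).2 hβ
  have hg : AEMeasurable (fun x => ENNReal.ofReal (Real.exp (β₁ * f x))) μ :=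
    (Real.measurable_exp.comp_aemeasurable (hf.const_mul β₁)).ennreal_ofReal
  have h := lintegral_rpow_le_rpow_lintegral_of_le_one hg hp0 hp1
  refine le_of_eq_of_le (lintegral_congr fun x => ?_) h
  rw [ENNReal.ofReal_rpow_of_pos (Real.exp_pos _), ← Real.exp_mul]
  congr 2
  field_simp

/-- **One tilt controls the smaller ones.** On a probability space, if `∫ exp(β₁ f) ≤ exp B` with
`0 < β₁` and `0 ≤ B`, then `∫ exp(β f) ≤ exp B` for every `0 ≤ β ≤ β₁`
(`lintegral_exp_mul_le_rpow` and `(exp B)^{β/β₁} ≤ exp B`). [folklore] -/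
theorem lintegral_exp_mul_le_of_le {α : Type*} [MeasurableSpace α] {μ : Measure α}
    [IsProbabilityMeasure μ] {f : α → ℝ} (hf : AEMeasurable f μ) {β β₁ B : ℝ} (hβ1 : 0 < β₁)
    (hβ0 : 0 ≤ β) (hβ : β ≤ β₁) (hB : 0 ≤ B)
    (h : ∫⁻ x, ENNReal.ofReal (Real.exp (β₁ * f x)) ∂μ ≤ ENNReal.ofReal (Real.exp B)) :
    ∫⁻ x, ENNReal.ofReal (Real.exp (β * f x)) ∂μ ≤ ENNReal.ofReal (Real.exp B) := by
  have hp0 : 0 ≤ β / β₁ := div_nonneg hβ0 hβ1.le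
  have hp1 : β / β₁ ≤ 1 := (div_le_one hβ1).2 hβ
  calc ∫⁻ x, ENNReal.ofReal (Real.exp (β * f x)) ∂μ
      ≤ (∫⁻ x, ENNReal.ofReal (Real.exp (β₁ * f x)) ∂μ) ^ (β / β₁) :=
        lintegral_exp_mul_le_rpow hf hβ1 hβ0 hβ
    _ ≤ (ENNReal.ofReal (Real.exp B)) ^ (β / β₁) := ENNReal.rpow_le_rpow h hp0
    _ = ENNReal.ofReal (Real.exp (β / β₁ * B)) := by
        rw [ENNReal.ofReal_rpow_of_pos (Real.exp_pos _), ← Real.exp_mul, mul_comm]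
    _ ≤ ENNReal.ofReal (Real.exp B) := by
        refine ENNReal.ofReal_le_ofReal (Real.exp_le_exp.2 ?_)
        nlinarith

/-! ### The window functional of the kinetic shear stress -/

/-- The window functional of the kinetic shear stress is odd in the test function:
`W(-φ) = -W(φ)` pointwise (linearity of the interval integral; no integrability needed).
[folklore] -/
theorem shearWindowSum_neg {ε : ℝ} {n : ℕ}
    (Φ : HardSphereFlow (Torus.geometry (Fin 3)) ε n) (φ : T3 → ℝ) (w : ℝ)
    (z : Config n (Fin 3) T3) :
    ∑ i, w⁻¹ * ∫ r in (0 : ℝ)..w, (-φ (Φ.flow r z i).1) * ((Φ.flow r z i).2 0 * (Φ.flow r z i).2 1) =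
      -∑ i, w⁻¹ * ∫ r in (0 : ℝ)..w, φ (Φ.flow r z i).1 * ((Φ.flow r z i).2 0 * (Φ.flow r z i).2 1) := by
  rw [← Finset.sum_neg_distrib]
  refine Finset.sum_congr rfl fun i _ => ?_
  rw [← mul_neg, ← intervalIntegral.integral_neg]
  congr 1
  refine intervalIntegral.integral_congr fun r _ => ?_
  simp only [neg_mul]

/-- The window functional of the kinetic shear stress is a.e.-measurable under the global Gibbs law
(carried by the good set). [folklore] -/
theorem aemeasurable_shearWindowSum (σ a₀ θ₀ : ℝ) (N : ℕ)
    (Φ : HardSphereFlow (Torus.geometry (Fin 3)) (hsDiameter σ N) (N + 1))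
    {φ : T3 → ℝ} (hφ : Continuous φ) (w : ℝ) :
    AEMeasurable (fun z => ∑ i : Fin (N + 1), w⁻¹ *
        ∫ r in (0 : ℝ)..w, φ (Φ.flow r z i).1 * ((Φ.flow r z i).2 0 * (Φ.flow r z i).2 1))
      (localGibbsLaw σ (fun _ => a₀) (fun _ => 0) (fun _ => θ₀) N Φ) := by
  have hF : Continuous fun y : T3 × V3 => φ y.1 * (y.2 0 * y.2 1) := by fun_prop
  have h := aemeasurable_windowSum Φ (localGibbsLaw_const_compl_good σ a₀ θ₀ 0 N Φ) hF 1 w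
  simpa only [one_mul] using h

/-! ### The normal form -/

/-- **Normal form of `EquilibriumShearWindowLD`** (stmt-AtomisticToContinuum-14446): the item is
equivalent to its version with UNIT ACTIVITY and ONE POSITIVE TILT per test function —
`∃ σ₀ > 0 ∀ θ₀ > 0 ∀ σ ∈ (0, σ₀) ∀ Φ ∀ φ continuous ∃ β > 0 ∀ ε > 0 ∃ τ > 0 ∃ N₀ ∀ N ≥ N₀,
M_N(β, τ; φ) ≤ exp(ε(N+1))` under `G_N = localGibbsLaw σ 1 0 θ₀ N (Φ N)`.
(`→`: specialise to `a₀ = 1`, `β = β₀`. `←`: the activity cancels,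
`localGibbsLaw_const_activity`; given `φ`, take the tilts `β₊` for `φ` and `β₋` for `-φ` and
`β₀ := min β₊ β₋`; a tilt `0 ≤ β ≤ β₀` is controlled by `β₊` through Lyapunov's inequality
`lintegral_exp_mul_le_of_le` (the Gibbs law is a probability measure for `σ ≤ 1/2`), a tilt
`-β₀ ≤ β < 0` is the tilt `-β` of `-φ`, `shearWindowSum_neg`.) The dynamical content of the item
is untouched. [folklore] -/
theorem equilibriumShearWindowLD_iff_single_tilt :
    EquilibriumShearWindowLD ↔
      ∃ σ₀ : ℝ, 0 < σ₀ ∧ ∀ θ₀ : ℝ, 0 < θ₀ → ∀ σ : ℝ, 0 < σ → σ < σ₀ →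
        ∀ Φ : (N : ℕ) → HardSphereFlow (Torus.geometry (Fin 3)) (hsDiameter σ N) (N + 1),
        ∀ φ : T3 → ℝ, Continuous φ → ∃ β : ℝ, 0 < β ∧ ∀ ε : ℝ, 0 < ε →
          ∃ τ : ℝ, 0 < τ ∧ ∃ N₀ : ℕ, ∀ N : ℕ, N₀ ≤ N →
            ∫⁻ z, ENNReal.ofReal (Real.exp (β * ∑ i : Fin (N + 1),
                (τ * ((N : ℝ) + 1) ^ (-(1 / 3 : ℝ)))⁻¹ *
                  ∫ r in (0 : ℝ)..(τ * ((N : ℝ) + 1) ^ (-(1 / 3 : ℝ))),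
                    φ ((Φ N).flow r z i).1 * (((Φ N).flow r z i).2 0 * ((Φ N).flow r z i).2 1)))
                ∂(localGibbsLaw σ (fun _ => 1) (fun _ => 0) (fun _ => θ₀) N (Φ N)) ≤
              ENNReal.ofReal (Real.exp (ε * ((N : ℝ) + 1))) := by
  constructor
  · rintro ⟨σ₀, hσ₀, h⟩
    refine ⟨σ₀, hσ₀, fun θ₀ hθ σ hσ hσσ Φ φ hφ => ?_⟩
    obtain ⟨β₀, hβ₀, hβ⟩ := h 1 θ₀ one_pos hθ σ hσ hσσ Φ φ hφ
    exact ⟨β₀, hβ₀, hβ β₀ (by rw [abs_of_pos hβ₀])⟩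
  · rintro ⟨σ₀, hσ₀, h⟩
    refine ⟨min σ₀ (1 / 2), lt_min hσ₀ (by norm_num), fun a₀ θ₀ ha hθ σ hσ hσσ Φ φ hφ => ?_⟩
    have hσσ₀ : σ < σ₀ := hσσ.trans_le (min_le_left _ _)
    have hσ2 : σ ≤ 1 / 2 := (hσσ.trans_le (min_le_right _ _)).le
    have hφn : Continuous fun x => -φ x := hφ.neg
    obtain ⟨βp, hβp, hp⟩ := h θ₀ hθ σ hσ hσσ₀ Φ φ hφ
    obtain ⟨βm, hβm, hm⟩ := h θ₀ hθ σ hσ hσσ₀ Φ (fun x => -φ x) hφn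
    refine ⟨min βp βm, lt_min hβp hβm, fun β hβ ε hε => ?_⟩
    rcases le_or_gt 0 β with hβ0 | hβ0
    · -- `0 ≤ β ≤ βp`: Lyapunov from the tilt `βp` of `φ`
      obtain ⟨τ, hτ, N₀, hN⟩ := hp ε hε
      refine ⟨τ, hτ, N₀, fun N hNN => ?_⟩
      have hβle : β ≤ βp := ((abs_of_nonneg hβ0).symm.le.trans hβ).trans (min_le_left _ _)
      haveI : IsProbabilityMeasure (localGibbsLaw σ (fun _ => a₀) (fun _ => 0) (fun _ => θ₀) N (Φ N)) :=
        isProbabilityMeasure_localGibbsLaw (a₀ := fun _ => a₀) (θ₀ := fun _ => θ₀)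
          (u₀ := fun _ => 0) continuous_const continuous_const continuous_const (fun _ => ha)
          (fun _ => hθ) hσ2 N (Φ N)
      have hB : 0 ≤ ε * ((N : ℝ) + 1) := by positivity
      have hN' := hN N hNN
      rw [← KineticWindowGronwallNegative.localGibbsLaw_const_activity ha.ne' σ θ₀ 0 N (Φ N)] at hN'
      exact lintegral_exp_mul_le_of_le (aemeasurable_shearWindowSum σ a₀ θ₀ N (Φ N) hφ _) hβp
        hβ0 hβle hB hN'
    · -- `-βm ≤ β < 0`: the tilt `-β` of `-φ`
      obtain ⟨τ, hτ, N₀, hN⟩ := hm ε hε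
      refine ⟨τ, hτ, N₀, fun N hNN => ?_⟩
      have hβle : -β ≤ βm := ((abs_of_neg hβ0).symm.le.trans hβ).trans (min_le_right _ _)
      haveI : IsProbabilityMeasure (localGibbsLaw σ (fun _ => a₀) (fun _ => 0) (fun _ => θ₀) N (Φ N)) :=
        isProbabilityMeasure_localGibbsLaw (a₀ := fun _ => a₀) (θ₀ := fun _ => θ₀)
          (u₀ := fun _ => 0) continuous_const continuous_const continuous_const (fun _ => ha)
          (fun _ => hθ) hσ2 N (Φ N)
      have hB : 0 ≤ ε * ((N : ℝ) + 1) := by positivity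
      have hN' := hN N hNN
      rw [← KineticWindowGronwallNegative.localGibbsLaw_const_activity ha.ne' σ θ₀ 0 N (Φ N)] at hN'
      have key := lintegral_exp_mul_le_of_le
        (aemeasurable_shearWindowSum σ a₀ θ₀ N (Φ N) hφn _) hβm (neg_pos.2 hβ0).le hβle hB hN'
      refine le_of_eq_of_le (lintegral_congr fun z => ?_) key
      rw [shearWindowSum_neg, mul_neg, neg_mul, neg_neg]

end Summit.AtomisticToContinuum.HydrodynamicLimit.Theorems

end
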